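/-
Copyright (c) 2026 the pub-hodgecm-mathlib formalisation cell (harness21).  Prover seat hodgecm-mathlib-K2E5-p16 (g7), Track B «K2-LIT»,
#184♮ = hLiu418 = `stmt-HodgeConjecture-24832`; S2-asm road (γ) packaging, FRAME BLOCK FILE 2 (K2Liu-p05 (g6) 14:53:23Z split «MINE = frames»): the READING FRAME
`fr_w : U(l) →* archLocal w`, `u ↦ ι_w κ(1,u)` on the (explicit, sign-adapted) Shimura frame of ★ `K2LiuHermitianTubeFrameSign`, packaged as an `∃` (no `def`):
matrix formula, continuity, and the place components of the reading points `pt v = archPiEquivCM⁻¹ (w ↦ fr_w (v w))`.  THEOREMS ONLY (no `def`, no `instance`,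
no notation, no `sorry`).
-/
import Summits.HodgeConjecture.HodgeConjecture.Theorems.K2LiuHermitianTubeFrameSign   -- ★ FILE 1: the explicit frame letters, `exists_tubeFrame_arch₄`
import Summits.HodgeConjecture.HodgeConjecture.Theorems.K2LiuArchFrameBridge          -- ★ S2-B: `kappa_mul`, `kappa_one`, `kappa_mem_UJ`, `kappa_self`
import Literature.NumberTheory.Automorphic.RelNormOneTorusArchDivisible             -- ★ `archPiEquivCM_apply`
import HarnessLib

/-!
# Crux `HLiu418`, Road (γ) frame block FILE 2: the reading frame `u ↦ ι_w κ(1,u)` as a homomorphism `U(l) →* U(J^𝔻)(L_w)`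

Cell `hodgecm-mathlib`, crux item hLiu418 = `stmt-HodgeConjecture-24832` (helper lane `--supports`, count-neutral).

For a TUBE FRAME `(T, T⁻¹)` in block letters (`T T⁻¹ = 1 = T⁻¹ T`, `Tᴴ (i·J) T = H`) and a subgroup `U ≤ GL_{2l}(ℂ)` cut out by `g̃ᴴ H g̃ = H` (`g̃ = reindex e₂⁻¹ g`;
instance: ★ `mem_archLocal_hermD_iff`), the map `u ↦ reindex e₂ (T⁻¹ κ(1,u) T)`, `κ(k₁,k₂) = T₁ diag(k₁,k₂) ½T₁′` the compact chart of ★ `K2LiuArchFrameBridge`, IS a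
continuous homomorphism `U(l) →* U` (★ `kappa_mul`, ★ `kappa_one`, ★ `kappa_mem_UJ`, ★ `inv_conj_preserves`):
* §1 (generic frame) `frameMat_mul`, `frameMat_one`, `frameMat_mem` and **`exists_frameHom`** — `∃ φ : U(l) →* U`, matrix of `φ u` `= reindex e₂ (T⁻¹ κ(1,u) T)`, `Continuous φ`;
* §2 (CM instance, every complex place at once) **`exists_readingFrame`** — `∃ fr : ∀ w, U(n) →* archLocal L (n+n) J^𝔻 w` on the EXPLICIT Shimura frames of
  `t_w k = Re σ_w(dV dW)` (★ FILE 1 §5 letters), with the matrix formula, continuity, and the place components of the reading points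
  `archAt w′ (archPiEquivCM⁻¹ (w ↦ fr_w (v w))) = fr_{w′} (v w′)` (★ `archPiEquivCM_apply`).
FILE 3 reads off ★ FILE 1 §3 (`frameInv_kappa_frame`) the SIGN LETTER of these reading points (`archUFormPi_𝔻 (pt v) σ = kV (α, β)`, `det`s `(1, det v_{w(σ)})` in the order
fixed by the sign of `deltaIm σ`) — the `hfr∕hα∕hβ` of ★ `K2LiuArchSWAnchorCharacter`; the packaging ★ `K2LiuArchSWSpanningInstance.archSWRegionSpanning_of_systems`
(K2Liu-p05) instantiates its `fr` with §2.
References: [Shimura1997, §§5–6 (Case UT), §6.5]; [BorelJacquet1979, §4.1]; [Knapp1986, Ch. VII §1 (compact picture)].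
HONEST LABEL: HC_CM is proved only modulo the 7 printed citations (2 remaining named inputs: hLiu418 = stmt-HodgeConjecture-24832,
h413 = stmt-HodgeConjecture-24833) until rung 0 closes; count-neutral helper, closes no socket.
-/

set_option autoImplicit false
set_option linter.dupNamespace false

noncomputable section

namespace Summit.HodgeConjecture.HodgeConjecture.Cruxes.HLiu418.K2LiuArchReadingFrame

open Matrix Complex NumberField
open scoped MatrixGroups ComplexConjugate
open Literature.NumberTheory.Automorphic Literature.NumberTheory.Automorphic.UnitaryGroup
open Literature.NumberTheory.GelbartRogawski1991 Literature.NumberTheory.GelbartRogawski1991.GRConstruction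
open K2LiuHermitianTubeCocycle K2LiuHermitianTubeFrame K2LiuHermitianTubeFrameArch K2LiuHermitianTubeFrameArchInv K2LiuHermitianTubeFrameSign
open K2LiuArchFrameBridge K2LiuSiegelUnipotentLocalDefs

/-! ## §1 Generic frame: `u ↦ reindex e₂ (T⁻¹ κ(1,u) T)` is a continuous homomorphism `U(l) →* U` -/

section Generic

variable {n : ℕ} {T Tinv : Matrix (Fin n ⊕ Fin n) (Fin n ⊕ Fin n) ℂ}

/-- **multiplicativity**: `reindex e₂ (T⁻¹ κ(1,a) T) · reindex e₂ (T⁻¹ κ(1,b) T) = reindex e₂ (T⁻¹ κ(1,ab) T)` (★ `kappa_mul`, `T T⁻¹ = 1`). [cite: Shimura1997, §6.5] -/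
theorem frameMat_mul (h1 : T * Tinv = 1) (a b : Matrix (Fin n) (Fin n) ℂ) :
    Matrix.reindex (e₂ (n := n)) (e₂ (n := n))
        (Tinv * ((fromBlocks 1 1 (I • 1) (-(I • 1)) : Matrix (Fin n ⊕ Fin n) (Fin n ⊕ Fin n) ℂ) * fromBlocks 1 0 0 a *
          ((2 : ℂ)⁻¹ • fromBlocks 1 (-(I • 1)) 1 (I • 1))) * T) *
      Matrix.reindex (e₂ (n := n)) (e₂ (n := n))
        (Tinv * ((fromBlocks 1 1 (I • 1) (-(I • 1)) : Matrix (Fin n ⊕ Fin n) (Fin n ⊕ Fin n) ℂ) * fromBlocks 1 0 0 b *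
          ((2 : ℂ)⁻¹ • fromBlocks 1 (-(I • 1)) 1 (I • 1))) * T) =
      Matrix.reindex (e₂ (n := n)) (e₂ (n := n))
        (Tinv * ((fromBlocks 1 1 (I • 1) (-(I • 1)) : Matrix (Fin n ⊕ Fin n) (Fin n ⊕ Fin n) ℂ) * fromBlocks 1 0 0 (a * b) *
          ((2 : ℂ)⁻¹ • fromBlocks 1 (-(I • 1)) 1 (I • 1))) * T) := by
  rw [reindex_apply, reindex_apply, reindex_apply, submatrix_mul_equiv]
  congr 1
  rw [show Tinv * ((fromBlocks 1 1 (I • 1) (-(I • 1)) : Matrix (Fin n ⊕ Fin n) (Fin n ⊕ Fin n) ℂ) * fromBlocks 1 0 0 a *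
          ((2 : ℂ)⁻¹ • fromBlocks 1 (-(I • 1)) 1 (I • 1))) * T *
        (Tinv * ((fromBlocks 1 1 (I • 1) (-(I • 1)) : Matrix (Fin n ⊕ Fin n) (Fin n ⊕ Fin n) ℂ) * fromBlocks 1 0 0 b *
          ((2 : ℂ)⁻¹ • fromBlocks 1 (-(I • 1)) 1 (I • 1))) * T) =
      Tinv * (((fromBlocks 1 1 (I • 1) (-(I • 1)) : Matrix (Fin n ⊕ Fin n) (Fin n ⊕ Fin n) ℂ) * fromBlocks 1 0 0 a *
          ((2 : ℂ)⁻¹ • fromBlocks 1 (-(I • 1)) 1 (I • 1))) * ((T * Tinv) *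
        ((fromBlocks 1 1 (I • 1) (-(I • 1)) : Matrix (Fin n ⊕ Fin n) (Fin n ⊕ Fin n) ℂ) * fromBlocks 1 0 0 b *
          ((2 : ℂ)⁻¹ • fromBlocks 1 (-(I • 1)) 1 (I • 1))))) * T by simp only [Matrix.mul_assoc], h1, Matrix.one_mul, kappa_mul,
    Matrix.one_mul]

/-- **unit**: `reindex e₂ (T⁻¹ κ(1,1) T) = 1` (★ `kappa_one`, `T⁻¹ T = 1`). [cite: Shimura1997, §6.5] -/
theorem frameMat_one (h2 : Tinv * T = 1) :
    Matrix.reindex (e₂ (n := n)) (e₂ (n := n))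
        (Tinv * ((fromBlocks 1 1 (I • 1) (-(I • 1)) : Matrix (Fin n ⊕ Fin n) (Fin n ⊕ Fin n) ℂ) * fromBlocks 1 0 0 1 *
          ((2 : ℂ)⁻¹ • fromBlocks 1 (-(I • 1)) 1 (I • 1))) * T) = 1 := by
  rw [kappa_one, Matrix.mul_one, h2, reindex_apply, submatrix_one_equiv]

/-- **membership**: for a subgroup `U` cut out by `g̃ᴴ H g̃ = H` and a frame with `Tᴴ (i·J) T = H`, the matrix `reindex e₂ (T⁻¹ κ(1,u) T)` of a unitary `u` (with any
two-sided inverse) lies in `U` (★ `kappa_mem_UJ`, ★ `inv_conj_preserves`). [cite: Shimura1997, §§5–6] -/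
theorem frameMat_mem (h1 : T * Tinv = 1) (h2 : Tinv * T = 1) {H : Matrix (Fin n ⊕ Fin n) (Fin n ⊕ Fin n) ℂ} (hT : Tᴴ * (I • Matrix.J (Fin n) ℂ) * T = H)
    (U : Subgroup (GL (Fin (n + n)) ℂ))
    (hU : ∀ g : GL (Fin (n + n)) ℂ, g ∈ U ↔
      (Matrix.reindex (e₂ (n := n)).symm (e₂ (n := n)).symm (g : Matrix (Fin (n + n)) (Fin (n + n)) ℂ))ᴴ * H *
        Matrix.reindex (e₂ (n := n)).symm (e₂ (n := n)).symm (g : Matrix (Fin (n + n)) (Fin (n + n)) ℂ) = H)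
    {u : Matrix (Fin n) (Fin n) ℂ} (hu : uᴴ * u = 1) (g : GL (Fin (n + n)) ℂ)
    (hg : (g : Matrix (Fin (n + n)) (Fin (n + n)) ℂ) = Matrix.reindex (e₂ (n := n)) (e₂ (n := n))
      (Tinv * ((fromBlocks 1 1 (I • 1) (-(I • 1)) : Matrix (Fin n ⊕ Fin n) (Fin n ⊕ Fin n) ℂ) * fromBlocks 1 0 0 u *
          ((2 : ℂ)⁻¹ • fromBlocks 1 (-(I • 1)) 1 (I • 1))) * T)) :
    g ∈ U := by
  rw [hU, hg, reindex_symm_reindex]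
  exact inv_conj_preserves hT h1 h2 (kappa_mem_UJ (by rw [conjTranspose_one, Matrix.one_mul]) hu)

/-- **THE FRAME HOMOMORPHISM**: `∃ φ : U(l) →* U` with matrix `reindex e₂ (T⁻¹ κ(1,u) T)` and `φ` continuous — `u ↦ ι κ(1,u)`, the compact-picture reading points in the group.
[cite: Shimura1997, §6.5] [cite: Knapp1986, Ch. VII §1] [cite: BorelJacquet1979, §4.1] -/
theorem exists_frameHom (h1 : T * Tinv = 1) (h2 : Tinv * T = 1) {H : Matrix (Fin n ⊕ Fin n) (Fin n ⊕ Fin n) ℂ} (hT : Tᴴ * (I • Matrix.J (Fin n) ℂ) * T = H)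
    (U : Subgroup (GL (Fin (n + n)) ℂ))
    (hU : ∀ g : GL (Fin (n + n)) ℂ, g ∈ U ↔
      (Matrix.reindex (e₂ (n := n)).symm (e₂ (n := n)).symm (g : Matrix (Fin (n + n)) (Fin (n + n)) ℂ))ᴴ * H *
        Matrix.reindex (e₂ (n := n)).symm (e₂ (n := n)).symm (g : Matrix (Fin (n + n)) (Fin (n + n)) ℂ) = H) :
    ∃ φ : Matrix.unitaryGroup (Fin n) ℂ →* U,
      (∀ u, (((φ u : U) : GL (Fin (n + n)) ℂ) : Matrix (Fin (n + n)) (Fin (n + n)) ℂ) =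
        Matrix.reindex (e₂ (n := n)) (e₂ (n := n))
          (Tinv * ((fromBlocks 1 1 (I • 1) (-(I • 1)) : Matrix (Fin n ⊕ Fin n) (Fin n ⊕ Fin n) ℂ) *
            fromBlocks 1 0 0 (u : Matrix (Fin n) (Fin n) ℂ) * ((2 : ℂ)⁻¹ • fromBlocks 1 (-(I • 1)) 1 (I • 1))) * T)) ∧
      Continuous φ := by
  -- the matrix family and its algebra
  let Mf : Matrix (Fin n) (Fin n) ℂ → Matrix (Fin (n + n)) (Fin (n + n)) ℂ := fun a =>
    Matrix.reindex (e₂ (n := n)) (e₂ (n := n))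
      (Tinv * ((fromBlocks 1 1 (I • 1) (-(I • 1)) : Matrix (Fin n ⊕ Fin n) (Fin n ⊕ Fin n) ℂ) * fromBlocks 1 0 0 a *
        ((2 : ℂ)⁻¹ • fromBlocks 1 (-(I • 1)) 1 (I • 1))) * T)
  have hmul : ∀ a b, Mf a * Mf b = Mf (a * b) := fun a b => frameMat_mul h1 a b
  have hone : Mf 1 = 1 := frameMat_one h2
  have hstar : ∀ u : Matrix.unitaryGroup (Fin n) ℂ, (u : Matrix (Fin n) (Fin n) ℂ) * star (u : Matrix (Fin n) (Fin n) ℂ) = 1 := fun u =>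
    Matrix.mem_unitaryGroup_iff.1 u.2
  have hstar' : ∀ u : Matrix.unitaryGroup (Fin n) ℂ, star (u : Matrix (Fin n) (Fin n) ℂ) * (u : Matrix (Fin n) (Fin n) ℂ) = 1 := fun u =>
    Matrix.mem_unitaryGroup_iff'.1 u.2
  -- the `GL`-valued map and its membership
  let G : Matrix.unitaryGroup (Fin n) ℂ → GL (Fin (n + n)) ℂ := fun u =>
    ⟨Mf u, Mf (star (u : Matrix (Fin n) (Fin n) ℂ)), by rw [hmul, hstar, hone], by rw [hmul, hstar', hone]⟩
  have hGmem : ∀ u, G u ∈ U := fun u =>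
    frameMat_mem h1 h2 hT U hU (by rw [← star_eq_conjTranspose]; exact hstar' u) (G u) rfl
  refine ⟨{ toFun := fun u => ⟨G u, hGmem u⟩, map_one' := ?_, map_mul' := ?_ }, fun u => rfl, ?_⟩
  · apply Subtype.ext; apply Units.ext
    show Mf ((1 : Matrix.unitaryGroup (Fin n) ℂ) : Matrix (Fin n) (Fin n) ℂ) = 1
    rw [OneMemClass.coe_one, hone]
  · intro u v
    apply Subtype.ext; apply Units.ext
    show Mf ((u * v : Matrix.unitaryGroup (Fin n) ℂ) : Matrix (Fin n) (Fin n) ℂ) = Mf u * Mf v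
    rw [Submonoid.coe_mul, hmul]
  · -- continuity: the matrix entries are polynomial in `u`
    have hκc : Continuous fun a : Matrix (Fin n) (Fin n) ℂ =>
        Tinv * ((fromBlocks 1 1 (I • 1) (-(I • 1)) : Matrix (Fin n ⊕ Fin n) (Fin n ⊕ Fin n) ℂ) * fromBlocks 1 0 0 a *
          ((2 : ℂ)⁻¹ • fromBlocks 1 (-(I • 1)) 1 (I • 1))) * T :=
      (continuous_const.mul ((continuous_const.mul
        (Continuous.matrix_fromBlocks continuous_const continuous_const continuous_const continuous_id)).mul continuous_const)).mul
        continuous_const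
    have hMc : Continuous Mf := hκc.matrix_submatrix _ _
    refine Continuous.subtype_mk (Units.continuous_iff.2 ⟨?_, ?_⟩) _
    · exact hMc.comp continuous_subtype_val
    · show Continuous fun u : Matrix.unitaryGroup (Fin n) ℂ => Mf (star (u : Matrix (Fin n) (Fin n) ℂ))
      exact hMc.comp (continuous_subtype_val.star)

end Generic

/-! ## §2 The CM instance: the reading frames at every complex place, on the explicit Shimura frames -/

section CM

variable (L : Type) [Field L] [NumberField L] [IsCMField L] {N M n : ℕ} (e : Fin N × Fin M ≃ Fin n)
  (dV : Fin N → L) (hdV : ∀ i, IsCMField.complexConj L (dV i) = dV i)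
  (dW : Fin M → L) (hdW : ∀ i, IsCMField.complexConj L (dW i) = dW i)

/-- the place components of `archPiEquivCM⁻¹ f` are the `f w` (★ `archPiEquivCM_apply`; any proof of `c • w = w`). [cite: BorelJacquet1979, §4.1] -/
theorem archAt_archPiEquivCM_symm {N₀ : ℕ} (H : Matrix (Fin N₀) (Fin N₀) L) (f : ∀ w : {w : InfinitePlace L // w.IsComplex}, archLocal L N₀ H w)
    (w : {w : InfinitePlace L // w.IsComplex}) (hw : IsCMField.complexConj L • w.1 = w.1) :
    archAt (Fp L) L (IsCMField.complexConj L) N₀ H w hw (IsCMField.complexConj_ne_one L) ((archPiEquivCM N₀ L H).symm f) = f w := by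
  have h : archAt (Fp L) L (IsCMField.complexConj L) N₀ H w hw (IsCMField.complexConj_ne_one L) ((archPiEquivCM N₀ L H).symm f) =
      archPiEquivCM N₀ L H ((archPiEquivCM N₀ L H).symm f) w := rfl
  rw [h, ContinuousMulEquiv.apply_symm_apply]

/-- **THE READING FRAMES OF THE DOUBLED CM DATUM** (every complex place `w` at once): on the EXPLICIT Shimura frame `(T_w, T_w⁻¹)` of `t_w k = Re σ_w(dV_{(e⁻¹k).1} dW_{(e⁻¹k).2})`
(★ FILE 1 §5 letters: `d = √(|t|∕2)`, `e = t∕|t|`, `T = (D D; C₀ −C₀)`, `T⁻¹ = (P₀ −P₁; P₀ P₁)`), there are continuous homomorphisms `fr_w : U(n) →* archLocal L (n+n) J^𝔻 w`,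
`u ↦ ι_w κ(1,u)`, with matrix `reindex e₂ (T_w⁻¹ κ(1,u) T_w)`; the place components of the reading points are `archAt w′ (archPiEquivCM⁻¹ (w ↦ fr_w (v w))) = fr_{w′} (v w′)`.
[cite: Shimura1997, §§5–6 (Case UT), §6.5] [cite: BorelJacquet1979, §4.1] [cite: Knapp1986, Ch. VII §1] -/
theorem exists_readingFrame (hdV0 : ∀ i, dV i ≠ 0) (hdW0 : ∀ j, dW j ≠ 0) :
    ∃ fr : ∀ w : {w : InfinitePlace L // w.IsComplex}, Matrix.unitaryGroup (Fin n) ℂ →* archLocal L (n + n) (hermD L e dV hdV dW hdW) w,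
      (∀ w u, ((((fr w u : archLocal L (n + n) (hermD L e dV hdV dW hdW) w) : GL (Fin (n + n)) ℂ)) : Matrix (Fin (n + n)) (Fin (n + n)) ℂ) =
        Matrix.reindex (e₂ (n := n)) (e₂ (n := n))
          (fromBlocks (diagonal (fun k => (((Real.sqrt (|(w.1.embedding (dV (e.symm k).1 * dW (e.symm k).2)).re| / 2))⁻¹ / 2 : ℝ) : ℂ)))
              (-diagonal (fun k => I * (((Real.sqrt (|(w.1.embedding (dV (e.symm k).1 * dW (e.symm k).2)).re| / 2))⁻¹ *
                ((w.1.embedding (dV (e.symm k).1 * dW (e.symm k).2)).re / |(w.1.embedding (dV (e.symm k).1 * dW (e.symm k).2)).re|) / 2 : ℝ) : ℂ)))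
              (diagonal (fun k => (((Real.sqrt (|(w.1.embedding (dV (e.symm k).1 * dW (e.symm k).2)).re| / 2))⁻¹ / 2 : ℝ) : ℂ)))
              (diagonal (fun k => I * (((Real.sqrt (|(w.1.embedding (dV (e.symm k).1 * dW (e.symm k).2)).re| / 2))⁻¹ *
                ((w.1.embedding (dV (e.symm k).1 * dW (e.symm k).2)).re / |(w.1.embedding (dV (e.symm k).1 * dW (e.symm k).2)).re|) / 2 : ℝ) : ℂ))) *
            ((fromBlocks 1 1 (I • 1) (-(I • 1)) : Matrix (Fin n ⊕ Fin n) (Fin n ⊕ Fin n) ℂ) * fromBlocks 1 0 0 (u : Matrix (Fin n) (Fin n) ℂ) *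
              ((2 : ℂ)⁻¹ • fromBlocks 1 (-(I • 1)) 1 (I • 1))) *
            fromBlocks (diagonal (fun k => (Real.sqrt (|(w.1.embedding (dV (e.symm k).1 * dW (e.symm k).2)).re| / 2) : ℂ)))
              (diagonal (fun k => (Real.sqrt (|(w.1.embedding (dV (e.symm k).1 * dW (e.symm k).2)).re| / 2) : ℂ)))
              (diagonal (fun k => I * ((((w.1.embedding (dV (e.symm k).1 * dW (e.symm k).2)).re / |(w.1.embedding (dV (e.symm k).1 * dW (e.symm k).2)).re|) *
                Real.sqrt (|(w.1.embedding (dV (e.symm k).1 * dW (e.symm k).2)).re| / 2) : ℝ) : ℂ)))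
              (-diagonal (fun k => I * ((((w.1.embedding (dV (e.symm k).1 * dW (e.symm k).2)).re / |(w.1.embedding (dV (e.symm k).1 * dW (e.symm k).2)).re|) *
                Real.sqrt (|(w.1.embedding (dV (e.symm k).1 * dW (e.symm k).2)).re| / 2) : ℝ) : ℂ))))) ∧
      (∀ w, Continuous (fr w)) ∧
      (∀ (v : {w : InfinitePlace L // w.IsComplex} → Matrix.unitaryGroup (Fin n) ℂ) (w : {w : InfinitePlace L // w.IsComplex})
        (hw : IsCMField.complexConj L • w.1 = w.1),
        archAt (Fp L) L (IsCMField.complexConj L) (n + n) (hermD L e dV hdV dW hdW) w hw (IsCMField.complexConj_ne_one L)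
          ((archPiEquivCM (n + n) L (hermD L e dV hdV dW hdW)).symm fun w' => (fr w' (v w') : archLocal L (n + n) (hermD L e dV hdV dW hdW) w')) =
          fr w (v w)) := by
  -- at each place: the explicit frame's ring letters
  have hfr : ∀ w : {w : InfinitePlace L // w.IsComplex},
      ∃ φ : Matrix.unitaryGroup (Fin n) ℂ →* archLocal L (n + n) (hermD L e dV hdV dW hdW) w,
        (∀ u, (((φ u : archLocal L (n + n) (hermD L e dV hdV dW hdW) w) : GL (Fin (n + n)) ℂ) : Matrix (Fin (n + n)) (Fin (n + n)) ℂ) =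
          Matrix.reindex (e₂ (n := n)) (e₂ (n := n))
            (fromBlocks (diagonal (fun k => (((Real.sqrt (|(w.1.embedding (dV (e.symm k).1 * dW (e.symm k).2)).re| / 2))⁻¹ / 2 : ℝ) : ℂ)))
                (-diagonal (fun k => I * (((Real.sqrt (|(w.1.embedding (dV (e.symm k).1 * dW (e.symm k).2)).re| / 2))⁻¹ *
                  ((w.1.embedding (dV (e.symm k).1 * dW (e.symm k).2)).re / |(w.1.embedding (dV (e.symm k).1 * dW (e.symm k).2)).re|) / 2 : ℝ) : ℂ)))
                (diagonal (fun k => (((Real.sqrt (|(w.1.embedding (dV (e.symm k).1 * dW (e.symm k).2)).re| / 2))⁻¹ / 2 : ℝ) : ℂ)))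
                (diagonal (fun k => I * (((Real.sqrt (|(w.1.embedding (dV (e.symm k).1 * dW (e.symm k).2)).re| / 2))⁻¹ *
                  ((w.1.embedding (dV (e.symm k).1 * dW (e.symm k).2)).re / |(w.1.embedding (dV (e.symm k).1 * dW (e.symm k).2)).re|) / 2 : ℝ) : ℂ))) *
              ((fromBlocks 1 1 (I • 1) (-(I • 1)) : Matrix (Fin n ⊕ Fin n) (Fin n ⊕ Fin n) ℂ) * fromBlocks 1 0 0 (u : Matrix (Fin n) (Fin n) ℂ) *
                ((2 : ℂ)⁻¹ • fromBlocks 1 (-(I • 1)) 1 (I • 1))) *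
              fromBlocks (diagonal (fun k => (Real.sqrt (|(w.1.embedding (dV (e.symm k).1 * dW (e.symm k).2)).re| / 2) : ℂ)))
                (diagonal (fun k => (Real.sqrt (|(w.1.embedding (dV (e.symm k).1 * dW (e.symm k).2)).re| / 2) : ℂ)))
                (diagonal (fun k => I * ((((w.1.embedding (dV (e.symm k).1 * dW (e.symm k).2)).re / |(w.1.embedding (dV (e.symm k).1 * dW (e.symm k).2)).re|) *
                  Real.sqrt (|(w.1.embedding (dV (e.symm k).1 * dW (e.symm k).2)).re| / 2) : ℝ) : ℂ)))
                (-diagonal (fun k => I * ((((w.1.embedding (dV (e.symm k).1 * dW (e.symm k).2)).re / |(w.1.embedding (dV (e.symm k).1 * dW (e.symm k).2)).re|) *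
                  Real.sqrt (|(w.1.embedding (dV (e.symm k).1 * dW (e.symm k).2)).re| / 2) : ℝ) : ℂ))))) ∧
        Continuous φ := by
    intro w
    have hw : IsCMField.complexConj L • w.1 = w.1 := complexConj_smul_infinitePlace L w.1
    have ht := tw_ne_zero L e dV hdV dW hdW w hw hdV0 hdW0
    have hd : ∀ i, Real.sqrt (|(w.1.embedding (dV (e.symm i).1 * dW (e.symm i).2)).re| / 2) ≠ 0 := fun i => (letters_of _ ht i).1
    have he : ∀ i, (w.1.embedding (dV (e.symm i).1 * dW (e.symm i).2)).re / |(w.1.embedding (dV (e.symm i).1 * dW (e.symm i).2)).re| *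
        ((w.1.embedding (dV (e.symm i).1 * dW (e.symm i).2)).re / |(w.1.embedding (dV (e.symm i).1 * dW (e.symm i).2)).re|) = 1 :=
      fun i => (letters_of _ ht i).2.1
    have ht' := fun i => (letters_of _ ht i).2.2
    exact exists_frameHom (frame_mul_frameInv (letters_R1 _ hd) (letters_R2 _ _ hd he)) (frameInv_mul_frame (letters_R3 _ _ hd he) (letters_R4 _ _ hd he))
      (frame_conjTranspose_mul_smul_J_mul _ _ _ ht') _ (mem_archLocal_hermD_iff L e dV hdV dW hdW w hw)
  choose fr hfr hfrc using hfr
  exact ⟨fr, hfr, hfrc, fun v w hw => archAt_archPiEquivCM_symm L _ _ w hw⟩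

end CM

end Summit.HodgeConjecture.HodgeConjecture.Cruxes.HLiu418.K2LiuArchReadingFrame

end
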